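import Summits.ResolutionOfSingularities.ResolutionOfSingularities.Theorems.WeightedInvariantWeightedConstructionCobordantPlusSmoothVerbatim
import Summits.ResolutionOfSingularities.ResolutionOfSingularities.Theorems.WeightedInvariantWeightedConstructionOffExceptional

/-!
# Pre-data and the reduction "verify axiom `(iv)` only at closed points of the exceptional divisor"

Route `ResolutionOfSingularities/WeightedInvariant`, crux `WeightedConstruction`
(stmt-ResolutionOfSingularities-0571, `∀ p prime, Nonempty (WeightedResolutionDatum p)`), line
`support-first-weights-second` of the crux chain, registered stub `stub_preDatum_toDatum`.

`PreDatum p` (an object the line posits) is the data and axioms of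
`Literature.AlgebraicGeometry.Resolution.WeightedResolutionDatum p` (one well-ordered value set `Γ`; for
every perfect field `k` of characteristic `p`, every smooth separated quasi-compact `f : Y → Spec k` and
every ideal sheaf `X` on `Y`, a rating `inv f X : Y → Γ` and a Rees algebra `centre f X`; axioms `(usc)`,
`(i)`, `(ii)`, `(iii)` verbatim) with axiom `(iv)` — the strict drop of `inv` at EVERY point of EVERY
cobordant chart `B₊(U)` with the strict transform — replaced by the weaker `(iv-exc)`: the drop is
demanded only at the CLOSED points of the exceptional divisor `V(t⁻¹) ⊆ B₊(U)`, and only for charts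
`B₊(U) → Spec k` that are smooth, separated and quasi-compact (so that a construction may USE the datum
axioms on the new pair). We prove `Nonempty (PreDatum p) → Nonempty (WeightedResolutionDatum p)`
keeping `Γ`, `inv`, `centre`:

* the charts `B₊(U) → Spec k` of a regular weighted centre on a smooth separated quasi-compact `Y` over a
  perfect field ARE smooth, separated and quasi-compact for EVERY affine open `U` — the planner's stub
  `stub_cobordantPlus_smooth`, landed as `SupportFirst.stub_cobordantPlus_smooth`
  (Theorems/…CobordantPlusSmoothVerbatim.lean; Włodarczyk, arXiv:2203.03090, 2.3.9; a second proof is the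
  ring core `stub_extReesAlgebra_regular_finiteType` + `stub_cobordantPlus_smooth_of_isRegularRing`);
* `PreDatum.inv_cobordantPlus_lt` — axiom `(iv)` for a pre-datum: an exceptional point specialises to a
  closed exceptional point of the quasi-compact chart (`IsClosed.exists_closed_singleton`), where the
  pre-datum supplies the drop, and the value does not decrease under specialisation (usc); off the
  exceptional divisor `stub_offExceptional` identifies the value with the value at the image point, which
  is off the support of the centre = the maximum locus (Włodarczyk §3.3.33: off `V(t⁻¹)` the chart is the
  trivial `𝔾ₘ`-bundle over `U ∖ V(J)`);
* `stub_preDatum_toDatum` — the registered stub; `PreDatum.ofDatum` — the trivial converse.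
-/

noncomputable section

open CategoryTheory AlgebraicGeometry TopologicalSpace
open Literature.AlgebraicGeometry.Resolution

set_option linter.dupNamespace false -- mandated namespace of this single-conjunct summit

namespace Summit.ResolutionOfSingularities.ResolutionOfSingularities.Theorems

/-- A **pre-datum** in characteristic `p`: the data and axioms of
`Literature.AlgebraicGeometry.Resolution.WeightedResolutionDatum p` with axiom `(iv)` (strict drop of
`inv` at every point of every chart `B₊(U)` with the strict transform) demanded ONLY at the points of
the exceptional divisor `V(t⁻¹) ⊆ B₊(U)` that are CLOSED in `B₊(U)` (field `inv_lt_of_onExceptional`),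
and only for charts `B₊(U) → Spec k` that are smooth, separated and quasi-compact. Every datum is a pre-datum; the converse
is `stub_preDatum_toDatum`. Shape: Włodarczyk, arXiv:2203.03090, §3.3.33 and Thm. 4.3.1. -/
structure PreDatum (p : ℕ) : Type 1 where
  /-- the value set of the invariant (one for all dimensions) -/
  Γ : Type
  /-- `Γ` is linearly ordered … -/
  [linearOrder : LinearOrder Γ]
  /-- … and well-ordered -/
  [wellFoundedLT : WellFoundedLT Γ]
  /-- the invariant `inv_{(Y,X)} : |Y| → Γ` (total; meaningful for `k` perfect of char `p`, `f` smooth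
  separated quasi-compact) -/
  inv : ∀ ⦃k : Type⦄ [Field k] ⦃Y : Scheme.{0}⦄, (Y ⟶ Spec (.of k)) → Y.IdealSheafData → Y → Γ
  /-- the weighted centre of `(Y, X)`, as a Rees algebra on `Y` (total) -/
  centre : ∀ ⦃k : Type⦄ [Field k] ⦃Y : Scheme.{0}⦄, (Y ⟶ Spec (.of k)) → Y.IdealSheafData →
    ReesAlgebraData Y
  /-- `(usc)` upper semicontinuity: superlevel sets are closed -/
  isClosed_superlevel : ∀ ⦃k : Type⦄ [Field k] [CharP k p] [PerfectField k] ⦃Y : Scheme.{0}⦄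
    (f : Y ⟶ Spec (.of k)) [Smooth f] [IsSeparated f] [QuasiCompact f] (X : Y.IdealSheafData)
    (γ : Γ), IsClosed {y : Y | γ ≤ inv f X y}
  /-- `(i)` functoriality of `inv` for smooth `k`-morphisms `g : Y₁ → Y` (`X` pulled back) -/
  inv_comap : ∀ ⦃k : Type⦄ [Field k] [CharP k p] [PerfectField k] ⦃Y Y₁ : Scheme.{0}⦄
    (f : Y ⟶ Spec (.of k)) [Smooth f] [IsSeparated f] [QuasiCompact f]
    (f₁ : Y₁ ⟶ Spec (.of k)) [Smooth f₁] [IsSeparated f₁] [QuasiCompact f₁]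
    (g : Y₁ ⟶ Y) [Smooth g], g ≫ f = f₁ →
    ∀ (X : Y.IdealSheafData) (y₁ : Y₁), inv f₁ (X.comap g) y₁ = inv f X (g y₁)
  /-- `(i)` functoriality of `inv` for extensions `φ : k → K` of perfect ground fields -/
  inv_baseChange : ∀ ⦃k : Type⦄ [Field k] [CharP k p] [PerfectField k]
    ⦃K : Type⦄ [Field K] [PerfectField K] (φ : k →+* K)
    ⦃Y YK : Scheme.{0}⦄ (f : Y ⟶ Spec (.of k)) [Smooth f] [IsSeparated f] [QuasiCompact f]
    (fK : YK ⟶ Spec (.of K)) (pr : YK ⟶ Y),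
    IsPullback pr fK f (Spec.map (CommRingCat.ofHom φ)) →
    ∀ (X : Y.IdealSheafData) (y : YK), inv fK (X.comap pr) y = inv f X (pr y)
  /-- `(ii)` `inv` is minimal at `y` iff `y ∉ X` or the local ring of `X` at `y` is regular -/
  isBot_inv_iff : ∀ ⦃k : Type⦄ [Field k] [CharP k p] [PerfectField k] ⦃Y : Scheme.{0}⦄
    (f : Y ⟶ Spec (.of k)) [Smooth f] [IsSeparated f] [QuasiCompact f] (X : Y.IdealSheafData)
    (y : Y), IsBot (inv f X y) ↔
      ∀ x : X.subscheme, X.subschemeι x = y → IsRegularLocalRing (X.subscheme.presheaf.stalk x)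
  /-- `(iii)` [guard: `inv` not everywhere minimal] the centre is a regular weighted centre … -/
  isRegularWeightedCentre_centre : ∀ ⦃k : Type⦄ [Field k] [CharP k p] [PerfectField k]
    ⦃Y : Scheme.{0}⦄ (f : Y ⟶ Spec (.of k)) [Smooth f] [IsSeparated f] [QuasiCompact f]
    (X : Y.IdealSheafData), (∃ y : Y, ¬ IsBot (inv f X y)) →
    (centre f X).IsRegularWeightedCentre
  /-- `(iii)` … supported exactly on the maximum locus of `inv` -/
  support_centre : ∀ ⦃k : Type⦄ [Field k] [CharP k p] [PerfectField k]
    ⦃Y : Scheme.{0}⦄ (f : Y ⟶ Spec (.of k)) [Smooth f] [IsSeparated f] [QuasiCompact f]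
    (X : Y.IdealSheafData), (∃ y : Y, ¬ IsBot (inv f X y)) →
    (centre f X).support = {y : Y | ∀ y' : Y, inv f X y' ≤ inv f X y}
  /-- `(i)` for the centre: functoriality for smooth SURJECTIVE `k`-morphisms -/
  centre_comap : ∀ ⦃k : Type⦄ [Field k] [CharP k p] [PerfectField k] ⦃Y Y₁ : Scheme.{0}⦄
    (f : Y ⟶ Spec (.of k)) [Smooth f] [IsSeparated f] [QuasiCompact f]
    (f₁ : Y₁ ⟶ Spec (.of k)) [Smooth f₁] [IsSeparated f₁] [QuasiCompact f₁]
    (g : Y₁ ⟶ Y) [Smooth g] [Surjective g], g ≫ f = f₁ →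
    ∀ (X : Y.IdealSheafData), (∃ y : Y, ¬ IsBot (inv f X y)) →
    ∀ n : ℕ, (centre f₁ (X.comap g)).piece n = ((centre f X).piece n).comap g
  /-- `(i)` for the centre: functoriality for extensions of perfect ground fields -/
  centre_baseChange : ∀ ⦃k : Type⦄ [Field k] [CharP k p] [PerfectField k]
    ⦃K : Type⦄ [Field K] [PerfectField K] (φ : k →+* K)
    ⦃Y YK : Scheme.{0}⦄ (f : Y ⟶ Spec (.of k)) [Smooth f] [IsSeparated f] [QuasiCompact f]
    (fK : YK ⟶ Spec (.of K)) (pr : YK ⟶ Y),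
    IsPullback pr fK f (Spec.map (CommRingCat.ofHom φ)) →
    ∀ (X : Y.IdealSheafData), (∃ y : Y, ¬ IsBot (inv f X y)) →
    ∀ n : ℕ, (centre fK (X.comap pr)).piece n = ((centre f X).piece n).comap pr
  /-- `(iv-exc)` [guard] AT CLOSED POINTS OF THE EXCEPTIONAL DIVISOR ONLY: for every affine chart `U`
  with `B₊(U) → Spec k` smooth, separated and quasi-compact, at every CLOSED point `b` of `B₊(U)` lying
  on `V(t⁻¹)`, `inv` of `(B₊(U), strict transform)` is strictly below `max_Y inv` -/
  inv_lt_of_onExceptional : ∀ ⦃k : Type⦄ [Field k] [CharP k p] [PerfectField k]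
    ⦃Y : Scheme.{0}⦄ (f : Y ⟶ Spec (.of k)) [Smooth f] [IsSeparated f] [QuasiCompact f]
    (X : Y.IdealSheafData), (∃ y : Y, ¬ IsBot (inv f X y)) →
    ∀ (U : Y.affineOpens), Smooth ((centre f X).cobordantPlusι U ≫ f) →
      IsSeparated ((centre f X).cobordantPlusι U ≫ f) →
      QuasiCompact ((centre f X).cobordantPlusι U ≫ f) →
      ∀ (b : (centre f X).cobordantPlus U), IsClosed ({b} : Set ((centre f X).cobordantPlus U)) →
        (affineCobordantBlowup.plusOpens ((centre f X).chartIdeals U)).ι b ∈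
          ((affineCobordantBlowup.exceptional ((centre f X).chartIdeals U)).support :
            Set (affineCobordantBlowup ((centre f X).chartIdeals U))) →
        ∀ y : Y, (∀ y' : Y, inv f X y' ≤ inv f X y) →
          inv ((centre f X).cobordantPlusι U ≫ f) ((centre f X).cobordantStrictTransform U X) b
            < inv f X y

namespace PreDatum

variable {p : ℕ} (P : PreDatum p)

/-- The value set of a pre-datum is linearly ordered (structure field as an instance). -/
instance instLinearOrder : LinearOrder P.Γ := P.linearOrder

/-- The value set of a pre-datum is well-ordered (structure field as an instance). -/
instance instWellFoundedLT : WellFoundedLT P.Γ := P.wellFoundedLT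

/-- **Every datum is a pre-datum** (forget that `(iv)` also holds off the exceptional divisor). -/
def ofDatum (D : WeightedResolutionDatum p) : PreDatum p where
  Γ := D.Γ
  inv := D.inv
  centre := D.centre
  isClosed_superlevel := D.isClosed_superlevel
  inv_comap := D.inv_comap
  inv_baseChange := D.inv_baseChange
  isBot_inv_iff := D.isBot_inv_iff
  isRegularWeightedCentre_centre := D.isRegularWeightedCentre_centre
  support_centre := D.support_centre
  centre_comap := D.centre_comap
  centre_baseChange := D.centre_baseChange
  inv_lt_of_onExceptional := fun _ _ _ _ _ f _ _ _ X hguard U _ _ _ b _ _ y hy =>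
    D.inv_cobordantPlus_lt f X hguard U b y hy

/-- **Axiom `(iv)` for a pre-datum.** At a point `b` of `B₊(U)`: the chart is smooth, separated and
quasi-compact over `k` (`SupportFirst.stub_cobordantPlus_smooth`, the centre being a regular
weighted centre under the guard); if `b` lies on the exceptional divisor the pre-datum supplies the
drop; otherwise `stub_offExceptional` says `inv b = inv (image of b)` and the image is off the support
of the centre, i.e. off the maximum locus, so its value is strictly below the maximum. -/
theorem inv_cobordantPlus_lt {k : Type} [Field k] [CharP k p] [PerfectField k]
    {Y : Scheme.{0}} (f : Y ⟶ Spec (.of k)) [Smooth f] [IsSeparated f] [QuasiCompact f]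
    (X : Y.IdealSheafData) (hguard : ∃ y : Y, ¬ IsBot (P.inv f X y))
    (U : Y.affineOpens) (b : (P.centre f X).cobordantPlus U) (y : Y)
    (hy : ∀ y' : Y, P.inv f X y' ≤ P.inv f X y) :
    P.inv ((P.centre f X).cobordantPlusι U ≫ f) ((P.centre f X).cobordantStrictTransform U X) b
      < P.inv f X y := by
  obtain ⟨hsm, hsep, hqc⟩ := SupportFirst.stub_cobordantPlus_smooth f (P.centre f X)
    (P.isRegularWeightedCentre_centre f X hguard) U
  by_cases hb : (affineCobordantBlowup.plusOpens ((P.centre f X).chartIdeals U)).ι b ∈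
      ((affineCobordantBlowup.exceptional ((P.centre f X).chartIdeals U)).support :
        Set (affineCobordantBlowup ((P.centre f X).chartIdeals U)))
  · -- an exceptional point specialises to a CLOSED exceptional point `x`, where the pre-datum drops,
    -- and `inv b ≤ inv x` by upper semicontinuity on the (smooth, separated, quasi-compact) chart
    haveI := hsm; haveI := hsep; haveI := hqc
    haveI : CompactSpace ((P.centre f X).cobordantPlus U) :=
      QuasiCompact.compactSpace_of_compactSpace ((P.centre f X).cobordantPlusι U ≫ f)
    set E : Set ((P.centre f X).cobordantPlus U) :=
      (affineCobordantBlowup.plusOpens ((P.centre f X).chartIdeals U)).ι ⁻¹'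
        ((affineCobordantBlowup.exceptional ((P.centre f X).chartIdeals U)).support :
          Set (affineCobordantBlowup ((P.centre f X).chartIdeals U))) with hE
    have hEc : IsClosed E :=
      (affineCobordantBlowup.exceptional ((P.centre f X).chartIdeals U)).support.isClosed.preimage
        (affineCobordantBlowup.plusOpens ((P.centre f X).chartIdeals U)).ι.continuous
    set S : Set ((P.centre f X).cobordantPlus U) :=
      {z | P.inv ((P.centre f X).cobordantPlusι U ≫ f) ((P.centre f X).cobordantStrictTransform U X) b ≤
        P.inv ((P.centre f X).cobordantPlusι U ≫ f) ((P.centre f X).cobordantStrictTransform U X) z}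
      with hS
    have hSc : IsClosed S := P.isClosed_superlevel _ _ _
    obtain ⟨x, hx, hxc⟩ := (isClosed_closure (s := ({b} : Set _))).exists_closed_singleton
      ⟨b, subset_closure (Set.mem_singleton b)⟩
    have hbE : b ∈ E := hb
    have hbS : b ∈ S := le_refl _
    have hxE : x ∈ E := (closure_minimal (Set.singleton_subset_iff.mpr hbE) hEc) hx
    have hxS : x ∈ S := (closure_minimal (Set.singleton_subset_iff.mpr hbS) hSc) hx
    exact lt_of_le_of_lt hxS (P.inv_lt_of_onExceptional f X hguard U hsm hsep hqc x hxc hxE y hy)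
  · obtain ⟨heq, hnot⟩ := stub_offExceptional p P.Γ P.inv P.inv_comap f X (P.centre f X) U
      hsm hsep hqc b hb
    rw [heq]
    rw [P.support_centre f X hguard] at hnot
    simp only [Set.mem_setOf_eq, not_forall, not_le] at hnot
    obtain ⟨y', hy'⟩ := hnot
    exact lt_of_lt_of_le hy' (hy y')

end PreDatum

/-- **Pre-datum ⇒ datum** (registered stub `stub_preDatum_toDatum`; the reduction "verify the drop only
on the exceptional divisor"): a pre-datum in characteristic `p` yields a weighted resolution datum in
characteristic `p` with the same `Γ`, `inv` and `centre`. -/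
theorem stub_preDatum_toDatum :
    ∀ p : ℕ, Nonempty (PreDatum p) → Nonempty (WeightedResolutionDatum p) := by
  rintro p ⟨P⟩
  exact ⟨{ Γ := P.Γ
           inv := P.inv
           centre := P.centre
           isClosed_superlevel := P.isClosed_superlevel
           inv_comap := P.inv_comap
           inv_baseChange := P.inv_baseChange
           isBot_inv_iff := P.isBot_inv_iff
           isRegularWeightedCentre_centre := P.isRegularWeightedCentre_centre
           support_centre := P.support_centre
           centre_comap := P.centre_comap
           centre_baseChange := P.centre_baseChange
           inv_cobordantPlus_lt := fun _ _ _ _ _ f _ _ _ X hguard U b y hy =>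
             P.inv_cobordantPlus_lt f X hguard U b y hy }⟩

end Summit.ResolutionOfSingularities.ResolutionOfSingularities.Theorems

end
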